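import Mathlib
import HarnessLib
import Summits.HubbardSuperconductivity.HubbardSuperconductivity.Theorems.KLProgrammeKLRegimeEngineV8PairTransferExport8

/-!
# Route `KLProgramme` — ENGINE child gen 8 (stmt-HubbardSuperconductivity-20437 `KLRegimeEngineV17F2`), skeleton-v2 class #5 / stub (c) under «Export8» (AMENDMENT 25
# SHRUNK TO «(X).3-KLTS-CAP», text-elect `G := klEngGeo14`): the inherited relative bar's NUMERIC SHARES under the `klTS`-keyed cap `r ≤ 2²⁰·(1 + klTS)`, cap-generic
# in `r` and instantiated at the deferred constant `klCT8` (cell gate-hubbard-kl, seat hubbard-kl-p1 g23; twin of `…V8PairTransferExport7Shares`, p1 g14)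

Under the direct door (`pairLadderStepAtV17F2_of_relFamilyK5_klCT8`, Export8 §4) the (c) closer fits `Tb := transferBarRelIdx L klEngGeoTh P (klCT8 …) β U (n−1) (n−1)` into the
(E2-F2)ₙ line slot by slot.  This file gives the shares as NUMERALS, reading k3c2-p2's `…V8DefsG14` (p661848: `transferBarRelIdx_le_slots_klEngGeo14_of_cap`,
`relBar_le_bars_klEngGeo14_of_cap`, `two_pow_80_mul_le_klEngGeo14_CF`, `klEngGeo14_phGain_ge`):
* **`transferBarRelIdx_klCT8_le_slots_klEngGeo14`** / **`relBar_klCT8_le_bars_klEngGeo14`** — the G14 hosting at `r := klCT8` (shares of record `(2⁻¹⁵, 2⁻⁵)`; the `hTb` binder);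
* `thermal_content_le_of_cap` / `klCT8_thermal_content_le` (`2r·15367·thermalBar klEngGeoTh ≤ 2⁻⁵·thermalBar G` once `2⁸⁰(2+klTS) ≤ G.CF`), `ph_share_le_of_cap` / `klCT8_ph_share_le`
  (`8r·15367/(2⁵²(2+klTS)) ≤ 2⁻¹⁵`) — the cap-twins of `klCT7_thermal_content_le` / `klCT7_ph_share_le`;
* `transferBarRelIdx_le_succ_shapes_of_cap` / `_uniform_le_of_cap` / **`_le_uniform_of_cap`** and their `klCT8` instances — the `klRelGain` form for the FT convolutions
  (prefactor `2²¹·15367·(1+klTS)`), its label-free part, and the uniform numeral `Tb ≤ (1+klTS)·(2⁷⁶(KlamU)² + 2³⁶(Klam|U|)³)` (the door's `r′`).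
Real arithmetic over landed lemmas; no definition; nothing about the model is asserted; nothing asserts (X).3, (c), K3 or superconductivity.  0 kit · 0 lit.
-/

noncomputable section

namespace Summit.HubbardSuperconductivity.HubbardSuperconductivity.Theorems.EngineV8

set_option linter.dupNamespace false -- summit = problem name (single-conjunct summit), D-0017

open Real Finset Literature.MathematicalPhysics.QuantumLattice Literature.Probability.LatticeModels
open Summit.HubbardSuperconductivity.HubbardSuperconductivity.Theorems.KLProgrammeLegKernels
open Summit.HubbardSuperconductivity.HubbardSuperconductivity.Theorems.KLRegimeSplit

section Shares

variable {L : ℕ}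

/-- **THE NUMERIC SHARES of the inherited bar at `(klCT8, klEngGeoTh)` against `klEngGeo14`** (`0 ≤ P.Klam`) — `transferBarRelIdx_le_slots_klEngGeo14_of_cap` at `r := klCT8 …`:
`Tb(n,n) ≤ 2⁻¹⁵·(KlamU)²·(G14.phGain (n+1) ρ_d + G14.phGain (n+1) ρ_x) + 2·klCT8·15367·(KlamU)²/L + 4·klCT8·15367·(Klam|U|)³·2^{−(n+1)} + 2⁻⁵·thermalBar G14 (n+1)`. -/
theorem transferBarRelIdx_klCT8_le_slots_klEngGeo14 {P : SplitConsts} (hKl : 0 ≤ P.Klam) (R : RenConsts) (Q₀ : EngConsts) (G' : GeoConsts) (β U : ℝ) (n : ℕ)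
    (Qm k k' : TorusSite 2 L) :
    transferBarRelIdx L klEngGeoTh P (klCT8 P R Q₀ G' klEngGeoTh) β U n n Qm k k' ≤
      (2 : ℝ)⁻¹ ^ 15 * ((P.Klam * U) ^ 2 * (klEngGeo14.phGain (n + 1) (klTorusNorm L (k - k')) + klEngGeo14.phGain (n + 1) (klTorusNorm L (k + k' - Qm)))) +
        2 * klCT8 P R Q₀ G' klEngGeoTh * 15367 * ((P.Klam * U) ^ 2 * ((L : ℝ))⁻¹) +
        4 * klCT8 P R Q₀ G' klEngGeoTh * 15367 * ((P.Klam * |U|) ^ 3 * ((2 : ℝ) ^ (n + 1))⁻¹) +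
        (2 : ℝ)⁻¹ ^ 5 * thermalBar klEngGeo14 P U β (n + 1) :=
  transferBarRelIdx_le_slots_klEngGeo14_of_cap (L := L) hKl (klCT8_nonneg P R Q₀ G' klEngGeoTh) (klCT8_le_cap P R Q₀ G' klEngGeoTh) β U n Qm k k'

/-- **THE INHERITED BAR BOOKS LIKE ONE STEP AT `klEngGeo14`, at `r := klCT8`** (the `hTb` binder of `outClass_hout_klEngGeo14_…`) — `relBar_le_bars_klEngGeo14_of_cap` at `klCT8`. -/
theorem relBar_klCT8_le_bars_klEngGeo14 {P : SplitConsts} (hKl : 0 ≤ P.Klam) (R : RenConsts) (Q₀ : EngConsts) (G' : GeoConsts) (β U : ℝ) (n : ℕ)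
    (Qm k k' : TorusSite 2 L) :
    transferBarRelIdx L klEngGeoTh P (klCT8 P R Q₀ G' klEngGeoTh) β U n n Qm k k' ≤
      gainBar klEngGeo14 P U (n + 1) (klTorusNorm L Qm) (klTorusNorm L (k - k')) (klTorusNorm L (k + k' - Qm)) +
        (2 * klCT8 P R Q₀ G' klEngGeoTh * 15367 * ((P.Klam * U) ^ 2 * ((L : ℝ))⁻¹) +
          4 * klCT8 P R Q₀ G' klEngGeoTh * 15367 * ((P.Klam * |U|) ^ 3 * ((2 : ℝ) ^ (n + 1))⁻¹)) +
        thermalBar klEngGeo14 P U β (n + 1) :=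
  relBar_le_bars_klEngGeo14_of_cap (L := L) hKl (klCT8_nonneg P R Q₀ G' klEngGeoTh) (klCT8_le_cap P R Q₀ G' klEngGeoTh) β U n Qm k k'

/-- **Thermal content under the cap `2²⁰(1+klTS)`** against an engine package with `2⁸⁰(2+klTS) ≤ G.CF` (e.g. `klEngGeo14`: `two_pow_80_mul_le_klEngGeo14_CF`):
`2r·15367·thermalBar klEngGeoTh P U β n ≤ 2⁻⁵·thermalBar G P U β n` — the cap-generic twin of `klCT7_thermal_content_le`. -/
theorem thermal_content_le_of_cap {G : GeoConsts} (hCF : (2 : ℝ) ^ 80 * (2 + klTS) ≤ G.CF) {r : ℝ} (hrc : r ≤ 2 ^ 20 * (1 + klTS))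
    (P : SplitConsts) (U β : ℝ) (n : ℕ) :
    2 * r * 15367 * thermalBar klEngGeoTh P U β n ≤ (2 : ℝ)⁻¹ ^ 5 * thermalBar G P U β n := by
  have hT := klTS_nonneg
  have hX : 0 ≤ (P.Klam * U) ^ 2 * ((4 : ℝ) ^ (nScales β - n))⁻¹ := by positivity
  unfold thermalBar
  rw [klEngGeoTh_CF]
  have h1 : 2 * r * 15367 * ((2 : ℝ) ^ 40 * (P.Klam * U) ^ 2 * ((4 : ℝ) ^ (nScales β - n))⁻¹) =
      (2 * r * 15367 * 2 ^ 40) * ((P.Klam * U) ^ 2 * ((4 : ℝ) ^ (nScales β - n))⁻¹) := by ring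
  have h2 : (2 : ℝ)⁻¹ ^ 5 * (G.CF * (P.Klam * U) ^ 2 * ((4 : ℝ) ^ (nScales β - n))⁻¹) = ((2 : ℝ)⁻¹ ^ 5 * G.CF) * ((P.Klam * U) ^ 2 * ((4 : ℝ) ^ (nScales β - n))⁻¹) := by
    ring
  rw [h1, h2]
  refine mul_le_mul_of_nonneg_right ?_ hX
  -- `2r·15367·2⁴⁰ ≤ 2·2²⁰(1+klTS)·2¹⁴·2⁴⁰ = 2⁷⁵(1+klTS) ≤ 2⁻⁵·2⁸⁰(2+klTS) ≤ 2⁻⁵·G.CF`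
  nlinarith

/-- **`klCT8`'s thermal content** against any engine package with `2⁸⁰(2+klTS) ≤ G.CF`: `2·klCT8·15367·thermalBar klEngGeoTh ≤ 2⁻⁵·thermalBar G`. -/
theorem klCT8_thermal_content_le {G : GeoConsts} (hCF : (2 : ℝ) ^ 80 * (2 + klTS) ≤ G.CF) (P : SplitConsts) (R : RenConsts) (Q₀ : EngConsts) (G' : GeoConsts)
    (U β : ℝ) (n : ℕ) :
    2 * klCT8 P R Q₀ G' klEngGeoTh * 15367 * thermalBar klEngGeoTh P U β n ≤ (2 : ℝ)⁻¹ ^ 5 * thermalBar G P U β n :=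
  thermal_content_le_of_cap hCF (klCT8_le_cap P R Q₀ G' klEngGeoTh) P U β n

/-- **Ph share under the cap `2²⁰(1+klTS)`** against the shell-log content `2⁵²(2+klTS)` of `klEngGeo14` (`klEngGeo14_phGain_ge`): `8r·15367/(2⁵²(2+klTS)) ≤ 2⁻¹⁵`
— the cap-generic twin of `klCT7_ph_share_le`. -/
theorem ph_share_le_of_cap {r : ℝ} (hrc : r ≤ 2 ^ 20 * (1 + klTS)) :
    8 * r * 15367 / (2 ^ 52 * (2 + klTS)) ≤ (2 : ℝ)⁻¹ ^ 15 := by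
  have hT := klTS_nonneg
  rw [div_le_iff₀ (by positivity)]
  nlinarith

/-- **`klCT8`'s ph share**: `8·klCT8·15367/(2⁵²(2+klTS)) ≤ 2⁻¹⁵`. -/
theorem klCT8_ph_share_le (P : SplitConsts) (R : RenConsts) (Q₀ : EngConsts) (G' Gth : GeoConsts) :
    8 * klCT8 P R Q₀ G' Gth * 15367 / (2 ^ 52 * (2 + klTS)) ≤ (2 : ℝ)⁻¹ ^ 15 :=
  ph_share_le_of_cap (klCT8_le_cap P R Q₀ G' Gth)

/-- **The `klRelGain`-form under the cap** (`0 ≤ r ≤ 2²⁰(1+klTS)`, `0 ≤ P.Klam`), prefactor numeric `2r·15367 ≤ 2²¹·15367·(1+klTS)`: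
`Tb(n,n) ≤ 2²¹·15367·(1+klTS)·{(KlamU)²·[4(g_d + 2^{−(n+1)}) + 4(g_x + 2^{−(n+1)}) + 1/L] + 2(Klam|U|)³2^{−(n+1)} + thermalBar klEngGeoTh (n+1)}` — the cap-generic twin of
`transferBarRelIdx_klCT7_le_succ_shapes` (the form `klam_relGain_angular_le` consumes against a windowed-mass weight). -/
theorem transferBarRelIdx_le_succ_shapes_of_cap {P : SplitConsts} (hKl : 0 ≤ P.Klam) {r : ℝ} (hr : 0 ≤ r) (hrc : r ≤ 2 ^ 20 * (1 + klTS)) (β U : ℝ) (n : ℕ)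
    (Qm k k' : TorusSite 2 L) :
    transferBarRelIdx L klEngGeoTh P r β U n n Qm k k' ≤
      2 ^ 21 * 15367 * (1 + klTS) * ((P.Klam * U) ^ 2 * (4 * (klRelGain (n + 1) (klTorusNorm L (k - k')) + ((2 : ℝ) ^ (n + 1))⁻¹) +
          4 * (klRelGain (n + 1) (klTorusNorm L (k + k' - Qm)) + ((2 : ℝ) ^ (n + 1))⁻¹) + ((L : ℝ))⁻¹) +
        2 * ((P.Klam * |U|) ^ 3 * ((2 : ℝ) ^ (n + 1))⁻¹) + thermalBar klEngGeoTh P U β (n + 1)) := by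
  have hT := klTS_nonneg
  refine (transferBarRelIdx_pinned_le_succ_shapes (L := L) klEngGeoTh_CF_nonneg hKl hr β U n Qm k k').trans ?_
  have hρd : 0 ≤ klTorusNorm L (k - k') := by unfold klTorusNorm; exact torusSupNorm_nonneg _
  have hρx : 0 ≤ klTorusNorm L (k + k' - Qm) := by unfold klTorusNorm; exact torusSupNorm_nonneg _
  have hB : 0 ≤ (P.Klam * U) ^ 2 * (4 * (klRelGain (n + 1) (klTorusNorm L (k - k')) + ((2 : ℝ) ^ (n + 1))⁻¹) +
        4 * (klRelGain (n + 1) (klTorusNorm L (k + k' - Qm)) + ((2 : ℝ) ^ (n + 1))⁻¹) + ((L : ℝ))⁻¹) +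
      2 * ((P.Klam * |U|) ^ 3 * ((2 : ℝ) ^ (n + 1))⁻¹) + thermalBar klEngGeoTh P U β (n + 1) := by
    have := klRelGain_nonneg (n + 1) hρd
    have := klRelGain_nonneg (n + 1) hρx
    have := thermalBar_nonneg' klEngGeoTh_CF_nonneg P U β (n + 1)
    have : 0 ≤ P.Klam * |U| := mul_nonneg hKl (abs_nonneg U)
    positivity
  refine mul_le_mul_of_nonneg_right ?_ hB
  nlinarith

/-- **`klCT8` instance of the `klRelGain`-form.** -/
theorem transferBarRelIdx_klCT8_le_succ_shapes {P : SplitConsts} (hKl : 0 ≤ P.Klam) (R : RenConsts) (Q₀ : EngConsts) (G' : GeoConsts) (β U : ℝ) (n : ℕ)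
    (Qm k k' : TorusSite 2 L) :
    transferBarRelIdx L klEngGeoTh P (klCT8 P R Q₀ G' klEngGeoTh) β U n n Qm k k' ≤
      2 ^ 21 * 15367 * (1 + klTS) * ((P.Klam * U) ^ 2 * (4 * (klRelGain (n + 1) (klTorusNorm L (k - k')) + ((2 : ℝ) ^ (n + 1))⁻¹) +
          4 * (klRelGain (n + 1) (klTorusNorm L (k + k' - Qm)) + ((2 : ℝ) ^ (n + 1))⁻¹) + ((L : ℝ))⁻¹) +
        2 * ((P.Klam * |U|) ^ 3 * ((2 : ℝ) ^ (n + 1))⁻¹) + thermalBar klEngGeoTh P U β (n + 1)) :=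
  transferBarRelIdx_le_succ_shapes_of_cap (L := L) hKl (klCT8_nonneg P R Q₀ G' klEngGeoTh) (klCT8_le_cap P R Q₀ G' klEngGeoTh) β U n Qm k k'

/-- **The UNIFORM (label-free) part under the cap**: `Tb(n,n) ≤ 2²¹·15367·(1+klTS)·(KlamU)²·4·(g_d + g_x) + U₀′(n+1)` with
`U₀′(n+1) := 2²¹·15367·(1+klTS)·{(KlamU)²·(8·2^{−(n+1)} + 1/L) + 2(Klam|U|)³2^{−(n+1)} + thermalBar klEngGeoTh (n+1)}` — cap-generic twin of `transferBarRelIdx_klCT7_uniform_le`. -/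
theorem transferBarRelIdx_uniform_le_of_cap {P : SplitConsts} (hKl : 0 ≤ P.Klam) {r : ℝ} (hr : 0 ≤ r) (hrc : r ≤ 2 ^ 20 * (1 + klTS)) (β U : ℝ) (n : ℕ)
    (Qm k k' : TorusSite 2 L) :
    transferBarRelIdx L klEngGeoTh P r β U n n Qm k k' ≤
      2 ^ 21 * 15367 * (1 + klTS) * ((P.Klam * U) ^ 2 * (4 * (klRelGain (n + 1) (klTorusNorm L (k - k')) + klRelGain (n + 1) (klTorusNorm L (k + k' - Qm))))) +
        2 ^ 21 * 15367 * (1 + klTS) * ((P.Klam * U) ^ 2 * (8 * ((2 : ℝ) ^ (n + 1))⁻¹ + ((L : ℝ))⁻¹) + 2 * ((P.Klam * |U|) ^ 3 * ((2 : ℝ) ^ (n + 1))⁻¹) +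
          thermalBar klEngGeoTh P U β (n + 1)) := by
  refine (transferBarRelIdx_le_succ_shapes_of_cap (L := L) hKl hr hrc β U n Qm k k').trans (le_of_eq ?_)
  ring

/-- **`klCT8` instance of the label-free part.** -/
theorem transferBarRelIdx_klCT8_uniform_le {P : SplitConsts} (hKl : 0 ≤ P.Klam) (R : RenConsts) (Q₀ : EngConsts) (G' : GeoConsts) (β U : ℝ) (n : ℕ)
    (Qm k k' : TorusSite 2 L) :
    transferBarRelIdx L klEngGeoTh P (klCT8 P R Q₀ G' klEngGeoTh) β U n n Qm k k' ≤
      2 ^ 21 * 15367 * (1 + klTS) * ((P.Klam * U) ^ 2 * (4 * (klRelGain (n + 1) (klTorusNorm L (k - k')) + klRelGain (n + 1) (klTorusNorm L (k + k' - Qm))))) +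
        2 ^ 21 * 15367 * (1 + klTS) * ((P.Klam * U) ^ 2 * (8 * ((2 : ℝ) ^ (n + 1))⁻¹ + ((L : ℝ))⁻¹) + 2 * ((P.Klam * |U|) ^ 3 * ((2 : ℝ) ^ (n + 1))⁻¹) +
          thermalBar klEngGeoTh P U β (n + 1)) :=
  transferBarRelIdx_uniform_le_of_cap (L := L) hKl (klCT8_nonneg P R Q₀ G' klEngGeoTh) (klCT8_le_cap P R Q₀ G' klEngGeoTh) β U n Qm k k'

/-- **THE UNIFORM NUMERAL for `r′` under the cap**: for `0 ≤ P.Klam`, `1 ≤ L`, `0 ≤ r ≤ 2²⁰(1+klTS)`,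
`Tb(n,n) ≤ (1 + klTS)·(2⁷⁶·(KlamU)² + 2³⁶·(Klam|U|)³)` at every label — cap-generic twin of `transferBarRelIdx_klCT7_le_uniform` (the admissible `r′` of the direct door's
rows `Tb ≤ r′`, `(3/2·m + r′)·Σ|w₁| ≤ 1/3`: a pure U-door entry). -/
theorem transferBarRelIdx_le_uniform_of_cap {L : ℕ} (hL : 1 ≤ L) {P : SplitConsts} (hKl : 0 ≤ P.Klam) {r : ℝ} (hr : 0 ≤ r) (hrc : r ≤ 2 ^ 20 * (1 + klTS))
    (β U : ℝ) (n : ℕ) (Qm k k' : TorusSite 2 L) :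
    transferBarRelIdx L klEngGeoTh P r β U n n Qm k k' ≤ (1 + klTS) * (2 ^ 76 * (P.Klam * U) ^ 2 + 2 ^ 36 * (P.Klam * |U|) ^ 3) := by
  have hT := klTS_nonneg
  refine (transferBarRelIdx_le_succ_shapes_of_cap (L := L) hKl hr hrc β U n Qm k k').trans ?_
  have hρd : 0 ≤ klTorusNorm L (k - k') := by unfold klTorusNorm; exact torusSupNorm_nonneg _
  have hρx : 0 ≤ klTorusNorm L (k + k' - Qm) := by unfold klTorusNorm; exact torusSupNorm_nonneg _
  have hgd := klRelGain_le_uniform (n + 1) hρd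
  have hgx := klRelGain_le_uniform (n + 1) hρx
  have h2 : ((2 : ℝ) ^ (n + 1))⁻¹ ≤ 1 / 2 := by
    rw [pow_succ, mul_inv]
    have : ((2 : ℝ) ^ n)⁻¹ ≤ 1 := inv_le_one_of_one_le₀ (one_le_pow₀ (by norm_num))
    nlinarith
  have h2' : 0 ≤ ((2 : ℝ) ^ (n + 1))⁻¹ := by positivity
  have hL1 : ((L : ℝ))⁻¹ ≤ 1 := inv_le_one_of_one_le₀ (by exact_mod_cast hL)
  have hth := thermalBar_klEngGeoTh_le P U β (n + 1)
  have hU2 : 0 ≤ (P.Klam * U) ^ 2 := by positivity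
  have hU3 : 0 ≤ (P.Klam * |U|) ^ 3 := by have := mul_nonneg hKl (abs_nonneg U); positivity
  -- bracket ≤ (24 + 2^40)·(KlamU)² + (Klam|U|)³
  have hbr : (P.Klam * U) ^ 2 * (4 * (klRelGain (n + 1) (klTorusNorm L (k - k')) + ((2 : ℝ) ^ (n + 1))⁻¹) +
          4 * (klRelGain (n + 1) (klTorusNorm L (k + k' - Qm)) + ((2 : ℝ) ^ (n + 1))⁻¹) + ((L : ℝ))⁻¹) +
        2 * ((P.Klam * |U|) ^ 3 * ((2 : ℝ) ^ (n + 1))⁻¹) + thermalBar klEngGeoTh P U β (n + 1) ≤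
      (24 + 2 ^ 40) * (P.Klam * U) ^ 2 + (P.Klam * |U|) ^ 3 := by
    have hA : 4 * (klRelGain (n + 1) (klTorusNorm L (k - k')) + ((2 : ℝ) ^ (n + 1))⁻¹) +
        4 * (klRelGain (n + 1) (klTorusNorm L (k + k' - Qm)) + ((2 : ℝ) ^ (n + 1))⁻¹) + ((L : ℝ))⁻¹ ≤ 24 := by linarith
    nlinarith [mul_le_mul_of_nonneg_left hA hU2, mul_le_mul_of_nonneg_left h2 hU3]
  have hpos : 0 ≤ 2 ^ 21 * 15367 * (1 + klTS) := by positivity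
  calc 2 ^ 21 * 15367 * (1 + klTS) * ((P.Klam * U) ^ 2 * (4 * (klRelGain (n + 1) (klTorusNorm L (k - k')) + ((2 : ℝ) ^ (n + 1))⁻¹) +
          4 * (klRelGain (n + 1) (klTorusNorm L (k + k' - Qm)) + ((2 : ℝ) ^ (n + 1))⁻¹) + ((L : ℝ))⁻¹) +
        2 * ((P.Klam * |U|) ^ 3 * ((2 : ℝ) ^ (n + 1))⁻¹) + thermalBar klEngGeoTh P U β (n + 1))
      ≤ 2 ^ 21 * 15367 * (1 + klTS) * ((24 + 2 ^ 40) * (P.Klam * U) ^ 2 + (P.Klam * |U|) ^ 3) := mul_le_mul_of_nonneg_left hbr hpos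
    _ ≤ (1 + klTS) * (2 ^ 76 * (P.Klam * U) ^ 2 + 2 ^ 36 * (P.Klam * |U|) ^ 3) := by
        have h76 : (2 : ℝ) ^ 21 * 15367 * (24 + 2 ^ 40) ≤ 2 ^ 76 := by norm_num
        have h36 : (2 : ℝ) ^ 21 * 15367 ≤ 2 ^ 36 := by norm_num
        have hT1 : 0 ≤ 1 + klTS := by positivity
        nlinarith [mul_le_mul_of_nonneg_left (mul_le_mul_of_nonneg_right h76 hU2) hT1, mul_le_mul_of_nonneg_left (mul_le_mul_of_nonneg_right h36 hU3) hT1]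

/-- **`klCT8` instance of the uniform numeral**: `Tb(n,n) ≤ (1 + klTS)·(2⁷⁶·(KlamU)² + 2³⁶·(Klam|U|)³)` (`1 ≤ L`, `0 ≤ P.Klam`). -/
theorem transferBarRelIdx_klCT8_le_uniform {L : ℕ} (hL : 1 ≤ L) {P : SplitConsts} (hKl : 0 ≤ P.Klam) (R : RenConsts) (Q₀ : EngConsts) (G' : GeoConsts)
    (β U : ℝ) (n : ℕ) (Qm k k' : TorusSite 2 L) :
    transferBarRelIdx L klEngGeoTh P (klCT8 P R Q₀ G' klEngGeoTh) β U n n Qm k k' ≤ (1 + klTS) * (2 ^ 76 * (P.Klam * U) ^ 2 + 2 ^ 36 * (P.Klam * |U|) ^ 3) :=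
  transferBarRelIdx_le_uniform_of_cap hL hKl (klCT8_nonneg P R Q₀ G' klEngGeoTh) (klCT8_le_cap P R Q₀ G' klEngGeoTh) β U n Qm k k'

end Shares

end Summit.HubbardSuperconductivity.HubbardSuperconductivity.Theorems.EngineV8

end
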